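import Literature.AlgebraicTopology.FundamentalGroup.RotationGroupSO3
import HarnessLib

/-!
# Crux `NonSimplyConnectedLatticeGap` (stmt-QuantumFields-16405), route `ConvexGribovBody`, line `Sketch` —
# stub `stub_center_sphere_le_ker_rotHom` (I6: the centre of `S³` lies in the kernel `{±1}` of `S³ → SO(3)`)

Skeleton line `Sketch` v3 of the crux
`Summit.QuantumFields.YangMills.Theses.ConvexGribovBody.NonSimplyConnectedLatticeGap` certifies the first
admissible instance `G = SO(3) = S³/{±1}` of the crux's hypothesis class (compact simple gauge groups with
`π₁(G) ≠ 0`). The simplicity clause of `SO(3)` is transferred from the unit quaternions `S³` along the tree's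
covering homomorphism `rotHom : S³ →* SO(3)` (`Literature/AlgebraicTopology/FundamentalGroup/RotationGroupSO3.lean`);
the transfer needs `Z(S³) ≤ ker rotHom`, which is this file's registered side-stub I6:

* a unit quaternion `q = a + b i + c j + d k` commuting with the unit quaternions `i` and `j` is real:
  comparing the `j`- and `k`-components of `i q = q i` gives `d = 0`, `c = 0`, and the `k`-component of
  `j q = q j` gives `b = 0`;
* then `a² = |q|² = 1`, so `q = ±1`, and `ker rotHom = {±1}` by the tree's `mem_ker_rotHom_iff`.

Helper lemmas are prefixed `sphereCenter_`. No named unproved facts are used.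
-/

set_option autoImplicit false

noncomputable section

namespace Summit.QuantumFields.YangMills.Theorems.NonSimplyConnectedLatticeGap

open Literature.AlgebraicTopology.FundamentalGroup Quaternion

/-- The quaternion unit `i = (0, 1, 0, 0)` lies on the unit sphere `S³ ⊂ ℍ`. [folklore] -/
theorem sphereCenter_qi_mem : (⟨0, 1, 0, 0⟩ : ℍ) ∈ Metric.sphere (0 : ℍ) 1 :=
  mem_sphere_of_sq_add_sq (α := 0) (β := 1) (by norm_num) _ (by simp [normSq_def'])

/-- The quaternion unit `j = (0, 0, 1, 0)` lies on the unit sphere `S³ ⊂ ℍ`. [folklore] -/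
theorem sphereCenter_qj_mem : (⟨0, 0, 1, 0⟩ : ℍ) ∈ Metric.sphere (0 : ℍ) 1 :=
  mem_sphere_of_sq_add_sq (α := 0) (β := 1) (by norm_num) _ (by simp [normSq_def'])

/-- **A unit quaternion commuting with every unit quaternion is real**: commuting with `i` kills the
`j`- and `k`-components, commuting with `j` kills the `i`-component. [folklore] -/
theorem sphereCenter_im_eq_zero (q : Metric.sphere (0 : ℍ) 1)
    (hq : ∀ g : Metric.sphere (0 : ℍ) 1, g * q = q * g) :
    (q : ℍ).imI = 0 ∧ (q : ℍ).imJ = 0 ∧ (q : ℍ).imK = 0 := by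
  have hi := congrArg Subtype.val (hq ⟨⟨0, 1, 0, 0⟩, sphereCenter_qi_mem⟩)
  have hj := congrArg Subtype.val (hq ⟨⟨0, 0, 1, 0⟩, sphereCenter_qj_mem⟩)
  simp only [Metric.unitSphere.coe_mul] at hi hj
  have h1 := congrArg (fun x : ℍ => x.imJ) hi
  have h2 := congrArg (fun x : ℍ => x.imK) hi
  have h3 := congrArg (fun x : ℍ => x.imK) hj
  simp only [imJ_mul, imK_mul] at h1 h2 h3
  refine ⟨?_, ?_, ?_⟩ <;> linarith

/-- **A central unit quaternion is `±1`**: it is real (`sphereCenter_im_eq_zero`) of norm one. [folklore] -/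
theorem sphereCenter_eq_one_or_eq_neg_one (q : Metric.sphere (0 : ℍ) 1)
    (hq : ∀ g : Metric.sphere (0 : ℍ) 1, g * q = q * g) : q = 1 ∨ q = -1 := by
  obtain ⟨hI, hJ, hK⟩ := sphereCenter_im_eq_zero q hq
  have hsq : (q : ℍ).re ^ 2 = 1 := by
    have hn := normSq_coe_sphere q
    rw [normSq_def', hI, hJ, hK] at hn
    linear_combination hn
  rcases sq_eq_one_iff.1 hsq with h | h
  · left
    have h1 : (q : ℍ) = 1 := by ext <;> simp [hI, hJ, hK, h]
    exact Subtype.ext (by simpa [Metric.unitSphere.coe_one] using h1)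
  · right
    have h1 : (q : ℍ) = -1 := by ext <;> simp [hI, hJ, hK, h]
    exact Subtype.ext (by simpa [Metric.unitSphere.coe_one] using h1)

/-- **STUB I6 — the centre of the unit quaternion group lies in the kernel `{±1}` of `S³ → SO(3)`** (a unit
quaternion commuting with `i` and `j` is real, hence `±1`; tree: `mem_ker_rotHom_iff`). [folklore] -/
theorem stub_center_sphere_le_ker_rotHom :
    Subgroup.center (Metric.sphere (0 : Quaternion ℝ) 1) ≤ Literature.AlgebraicTopology.FundamentalGroup.rotHom.ker := by
  intro q hq
  exact (mem_ker_rotHom_iff q).2 (sphereCenter_eq_one_or_eq_neg_one q (Subgroup.mem_center_iff.1 hq))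

end Summit.QuantumFields.YangMills.Theorems.NonSimplyConnectedLatticeGap

end
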